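/-
Copyright (c) 2026. Released under Apache 2.0 license.
-/
import Summits.RiemannHypothesis.RiemannHypothesis.Theorems.MotivicDoorSemilocalQuinticKernel
import Summits.RiemannHypothesis.RiemannHypothesis.Theorems.MotivicDoorSemilocalUndecicWitness
import HarnessLib

/-!
# Motivic door, semi-local ladder — kernel-checked numerics for the degree-11 certificate (part A)

Pub speedrun, cell `pub-rhdoor`, seat `lad-2`, generation 5 (KERNEL file A of rung R3⁻(0.57)).
Generation 4's interval machinery (`MotivicDoorSemilocalQuinticKernel.lean`: `hornerFI`, `wFI`,
scale `2^48`, `decide +kernel` only) made generic in the coefficient list and the `τ`-grid, and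
the first three of six blocks of the zeroth-order upper Riemann sum
`Σ_i w(a_i) (IΔ(τ_{i+1}) - IΔ(τ_i))`, `a_i = i/2000`, `τ_i = a_i / b = i/1140`, `i = 1 … 2279`,
for the degree-23 increment polynomial `Δ = polyR dU` of the degree-11 witness
(`IΔ = hornerR iU` its antiderivative, 25 rational coefficients).

* `gchunkR_le_of_check`: soundness of the generic block check;
* `checkChunkU_1/2/3`: blocks `i = 1 … 380`, `381 … 760`, `761 … 1140` pass with the scaled
  bounds `BU1`, `BU2`, `BU3`.

Part B (`…UndecicKernelB.lean`) has blocks 4–6, `Δ(log 2 / b)` and the tail constant.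
PROVED: everything (sorry-free; `decide +kernel`, no `native_decide`).
-/

set_option linter.dupNamespace false

noncomputable section

open Real Finset
open Literature.Analysis.ValidatedNumerics.Numerics

namespace Summit.RiemannHypothesis.RiemannHypothesis.Theorems.MotivicDoor.SemilocalUndecicKernel

open SemilocalKernel SemilocalUndecic

/-! ## Generic cell machinery (coefficient list `l`, `τ`-denominator `d`) -/

/-- `τ_i = i / d` as an interval. -/
def gtauFI (d i : ℕ) : FI := FI.ofFrac (i : ℤ) d

/-- Soundness of `gtauFI`. -/
theorem mem_gtauFI {d : ℕ} (hd : 0 < d) (i : ℕ) : FI.mem ((i : ℝ) / d) (gtauFI d i) := by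
  have := FI.mem_ofFrac (i : ℤ) (q := d) hd
  rw [gtauFI]
  convert this using 1; push_cast; ring

/-- Cell term `w(i/2000) · (I(τ_{i+1}) - I(τ_i))`, `I = hornerR l`, `τ_i = i/d` (real side). -/
def gcellR (l : List ℚ) (d : ℕ) (i : ℕ) : ℝ :=
  wR ((i : ℝ) / 2000) * (hornerR l (((i : ℝ) + 1) / d) - hornerR l ((i : ℝ) / d))

/-- Block sum `Σ_{k<n} gcellR (i₀ + k)` by structural recursion (real side). -/
def gchunkR (l : List ℚ) (d : ℕ) : ℕ → ℕ → ℝ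
  | _, 0 => 0
  | i0, n + 1 => gcellR l d i0 + gchunkR l d (i0 + 1) n

/-- `gchunkR` is the block sum. -/
theorem gchunkR_eq_sum (l : List ℚ) (d : ℕ) (i0 n : ℕ) :
    gchunkR l d i0 n = ∑ k ∈ range n, gcellR l d (i0 + k) := by
  induction n generalizing i0 with
  | zero => simp [gchunkR]
  | succ n ih =>
    rw [gchunkR, ih, Finset.sum_range_succ', add_comm, Nat.add_zero]
    refine congrArg₂ (· + ·) (Finset.sum_congr rfl fun k _ ↦ by rw [Nat.add_right_comm, Nat.add_assoc]) rfl

/-- Enclosure of `gcellR l d i`. -/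
def gcellFI (l : List ℚ) (d : ℕ) (i : ℕ) : Option FI :=
  match wFI i with
  | none => none
  | some W => some (W.mul ((hornerFI l (gtauFI d (i + 1))).sub (hornerFI l (gtauFI d i))))

/-- Enclosure of `gchunkR l d i₀ n`. -/
def gchunkFI (l : List ℚ) (d : ℕ) : ℕ → ℕ → Option FI
  | _, 0 => some (FI.ofInt 0)
  | i0, n + 1 =>
    match gcellFI l d i0, gchunkFI l d (i0 + 1) n with
    | some C, some S => some (C.add S)
    | _, _ => none

/-- The block check: the upper endpoint of the enclosure of `gchunkR l d i₀ n` is at most `B`. -/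
def gcheckChunk (l : List ℚ) (d : ℕ) (i0 n : ℕ) (B : ℤ) : Bool :=
  match gchunkFI l d i0 n with
  | some S => decide (S.hi ≤ B)
  | none => false

/-- Soundness of `gcellFI`. -/
theorem mem_gcellFI {l : List ℚ} {d : ℕ} (hd : 0 < d) {i : ℕ} {C : FI}
    (h : gcellFI l d i = some C) : FI.mem (gcellR l d i) C := by
  unfold gcellFI at h
  split at h
  · exact absurd h (by simp)
  · rename_i W hW
    rw [Option.some.injEq] at h
    subst h
    refine FI.mem_mul (mem_wFI hW) (FI.mem_sub ?_ (mem_hornerFI (mem_gtauFI hd i) l))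
    have := mem_hornerFI (mem_gtauFI hd (i + 1)) l
    convert this using 2; push_cast; ring

/-- Soundness of `gchunkFI`. -/
theorem mem_gchunkFI {l : List ℚ} {d : ℕ} (hd : 0 < d) :
    ∀ (i0 n : ℕ) {S : FI}, gchunkFI l d i0 n = some S → FI.mem (gchunkR l d i0 n) S
  | i0, 0, S, h => by
      simp only [gchunkFI, Option.some.injEq] at h
      subst h; simpa [gchunkR] using FI.mem_ofInt 0
  | i0, n + 1, S, h => by
      unfold gchunkFI at h
      split at h
      · rename_i C T hC hT
        rw [Option.some.injEq] at h
        subst h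
        rw [gchunkR]
        exact FI.mem_add (mem_gcellFI hd hC) (mem_gchunkFI hd (i0 + 1) n hT)
      · exact absurd h (by simp)

/-- Soundness of the generic block check. -/
theorem gchunkR_le_of_check {l : List ℚ} {d : ℕ} (hd : 0 < d) {i0 n : ℕ} {B : ℤ}
    (h : gcheckChunk l d i0 n B = true) : gchunkR l d i0 n ≤ (B : ℝ) / SC := by
  unfold gcheckChunk at h
  split at h
  · rename_i S hS
    have hm := mem_gchunkFI hd i0 n hS
    have hB : S.hi ≤ B := of_decide_eq_true h
    refine (FI.le_hi_div hm).trans ?_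
    exact div_le_div_of_nonneg_right (by exact_mod_cast hB) SC_pos.le
  · exact absurd h (by simp)

/-! ## Data of the degree-11 witness -/

/-- The antiderivative `IΔ` of `Δ = polyR dU` (`IΔ(0) = 0`), 25 rational coefficients. -/
def iU : List ℚ := [0, 0, 204800, 28770304/3, -89047040/3, 583507968/5, -5858111488/15,
  5465454592/7, -6545708032/7, 681457920, -4398377344/15, 67721472, -239749616/33, 0, 5496528/7, 0,
  -3011493/10, 0, 770023/12, 0, -12520651/1520, 0, 2431/4, 0, -29393/1472]

/-- Scaled upper bound of block 1 (`i = 1 … 380`). -/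
def BU1 : ℤ := 263614268059511175347
/-- Scaled upper bound of block 2 (`i = 381 … 760`). -/
def BU2 : ℤ := 307828834855163126685
/-- Scaled upper bound of block 3 (`i = 761 … 1140`). -/
def BU3 : ℤ := 165200623407855919000

/-! ## Blocks 1–3 (kernel evaluation) -/

set_option maxHeartbeats 0 in
/-- Block 1 passes. -/
theorem checkChunkU_1 : gcheckChunk iU 1140 1 380 BU1 = true := by
  decide +kernel

set_option maxHeartbeats 0 in
/-- Block 2 passes. -/
theorem checkChunkU_2 : gcheckChunk iU 1140 381 380 BU2 = true := by
  decide +kernel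

set_option maxHeartbeats 0 in
/-- Block 3 passes. -/
theorem checkChunkU_3 : gcheckChunk iU 1140 761 380 BU3 = true := by
  decide +kernel

/-- Blocks 1–3: `Σ_{i=1}^{1140} ≤ (BU1 + BU2 + BU3) / 2^48`. -/
theorem bulkA_le :
    gchunkR iU 1140 1 380 + gchunkR iU 1140 381 380 + gchunkR iU 1140 761 380
      ≤ ((BU1 + BU2 + BU3 : ℤ) : ℝ) / SC := by
  have hd : 0 < 1140 := by norm_num
  have h1 := gchunkR_le_of_check hd checkChunkU_1
  have h2 := gchunkR_le_of_check hd checkChunkU_2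
  have h3 := gchunkR_le_of_check hd checkChunkU_3
  push_cast at h1 h2 h3 ⊢
  have := SC_pos
  rw [add_div, add_div]
  linarith

end Summit.RiemannHypothesis.RiemannHypothesis.Theorems.MotivicDoor.SemilocalUndecicKernel

end
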